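import Literature.Probability.Distributions.GaussianWickTheorem
import Literature.Probability.LatticeModels.LocalPerturbationGaussian
import HarnessLib

/-!
# Wick's theorem (Isserlis) for Mathlib's multivariate Gaussian `N(0, S)` on `ℝ^ι`

Topic `Probability/Distributions`, namespace `Literature.Probability.Distributions.GaussianWick` (continued).

The instance of the general theorem of the sibling file `GaussianWickTheorem` (Wick's theorem for centred Gaussian processes,
`GaussianWick.integral_prod_eq_pairingSum`; Gaussian integration by parts `GaussianWick.integral_mul_prod_eq_sum`) for Mathlib's
multivariate Gaussian `ProbabilityTheory.multivariateGaussian 0 S` on `EuclideanSpace ℝ ι` with a positive semidefinite covariance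
matrix `S` (77 files of the tree use this measure).  The coordinate process `(y ↦ y_i)_i` is a Gaussian process (the tree's
`Literature.Probability.LatticeModels.isGaussianProcess_eval_multivariateGaussian`, file `LocalPerturbationGaussian`), centred
(`integral_eval_multivariateGaussian_zero`) with two-point function `S` (`integral_eval_mul_eval_multivariateGaussian`, from Mathlib's
`covariance_eval_multivariateGaussian`); hence

* **`integral_prod_eval_multivariateGaussian`**: `∫ ∏_{l<2k} y_{x l} dN(0,S) = 𝒢_k[S](x) = ∑_{pairings} ∏_{pairs} S_{x l, x l'}`
  for any `2k` coordinates `x : Fin (2k) → ι` (repetitions allowed), the tree's pairing functional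
  `Literature.Probability.LatticeModels.pairingSum`;
* `integral_prod_eval_multivariateGaussian_odd`: odd moments vanish;
* `integral_eval_mul_prod_multivariateGaussian`: the integration by parts
  `∫ y_a ∏_{j∈s} y_{c j} dN(0,S) = ∑_{j∈s} S_{a, c j} ∫ ∏_{i∈s∖{j}} y_{c i} dN(0,S)`.

Sources: S. Janson, *Gaussian Hilbert Spaces* (1997), Thm 1.28 / Rem 1.29; J. Glimm, A. Jaffe, *Quantum Physics* (2nd ed. 1987),
Thm 6.3.1 (6.3.3), §8.2 (8.2.4); L. Isserlis, Biometrika 12 (1918).  Theorems only; no definition, no named fact; standard axioms.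

Provenance (v1.1, docstring only): filed by the `lit-balaban` cell (Phase-2 proof seat p39) as a general instance its lattice
files cite; that cell's framing line applies to this file verbatim — statement-level skeleton of published theorems with
citation tags; proofs where landed; nothing here is a claim about the Yang–Mills mass gap.

## References

* [Janson1997] S. Janson, *Gaussian Hilbert Spaces*, Cambridge Tracts in Math. 129 (1997), Thm 1.28, Remarks 1.29–1.30.
* [GlimmJaffeQP1987] J. Glimm, A. Jaffe, *Quantum Physics. A Functional Integral Point of View*, 2nd ed. (1987), Thm 6.3.1,
  §8.2 (8.2.1)–(8.2.4).
* [Isserlis1918] L. Isserlis, Biometrika 12 (1918) 134–139.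
-/

noncomputable section

namespace Literature.Probability.Distributions

namespace GaussianWick

open MeasureTheory ProbabilityTheory Finset Literature.Probability.LatticeModels

variable {ι : Type*} [Fintype ι] [DecidableEq ι] {S : Matrix ι ι ℝ}

/-- `N(0, S)` is centred coordinatewise: `∫ y_i dN(0,S) = 0` (the mean of `multivariateGaussian m S` is `m`,
`integral_id_multivariateGaussian`). [cite: Janson1997, Thm 1.28] -/
theorem integral_eval_multivariateGaussian_zero (S : Matrix ι ι ℝ) (i : ι) :
    ∫ y, y i ∂multivariateGaussian 0 S = 0 := by
  have h := ContinuousLinearMap.integral_comp_comm (EuclideanSpace.proj i : EuclideanSpace ℝ ι →L[ℝ] ℝ)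
    (IsGaussian.integrable_id (μ := multivariateGaussian 0 S))
  simpa using h

/-- the two-point function of `N(0, S)` is `S`: `∫ y_iy_j dN(0,S) = S_{ij}` for positive semidefinite `S` (Mathlib's
`covariance_eval_multivariateGaussian` and centredness). [cite: Janson1997, Thm 1.28 (1.2)] -/
theorem integral_eval_mul_eval_multivariateGaussian (hS : S.PosSemidef) (i j : ι) :
    ∫ y, y i * y j ∂multivariateGaussian 0 S = S i j := by
  have hG := isGaussianProcess_eval_multivariateGaussian (0 : EuclideanSpace ℝ ι) S
  have h := covariance_eq_sub (μ := multivariateGaussian 0 S) (hG.hasGaussianLaw_eval i).memLp_two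
    (hG.hasGaussianLaw_eval j).memLp_two
  rw [covariance_eval_multivariateGaussian hS, integral_eval_multivariateGaussian_zero S i, zero_mul, sub_zero] at h
  exact h.symm

/-- **Wick's theorem for `N(0, S)`**: `∫ ∏_{l<2k} y_{x l} dN(0,S) = 𝒢_k[S](x) = ∑_{pairings} ∏_{pairs} S_{x l, x l'}` for every
positive semidefinite `S` and any `2k` coordinates (repetitions allowed). [cite: Janson1997, Thm 1.28 (1.2)]
[cite: GlimmJaffeQP1987, §8.2 (8.2.4)] [cite: Isserlis1918] -/
theorem integral_prod_eval_multivariateGaussian (hS : S.PosSemidef) (k : ℕ) (x : Fin (2 * k) → ι) :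
    ∫ y, ∏ l, y (x l) ∂multivariateGaussian 0 S = pairingSum (fun i j => S i j) k x := by
  rw [integral_prod_eq_pairingSum (isGaussianProcess_eval_multivariateGaussian 0 S)
    (integral_eval_multivariateGaussian_zero S) k x]
  exact pairingSum_congr_of_eq _ _ k x x fun l l' => integral_eval_mul_eval_multivariateGaussian hS (x l) (x l')

/-- odd moments of `N(0, S)` vanish: `∫ ∏_{l<2k+1} y_{x l} dN(0,S) = 0`. [cite: Janson1997, Rem. 1.29] [cite: GlimmJaffeQP1987, §8.2 (8.2.4)] -/
theorem integral_prod_eval_multivariateGaussian_odd (S : Matrix ι ι ℝ) (k : ℕ) (x : Fin (2 * k + 1) → ι) :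
    ∫ y, ∏ l, y (x l) ∂multivariateGaussian 0 S = 0 :=
  integral_prod_odd_eq_zero (isGaussianProcess_eval_multivariateGaussian 0 S)
    (integral_eval_multivariateGaussian_zero S) k x

/-- Gaussian integration by parts for `N(0, S)`: `∫ y_a ∏_{j∈s} y_{c j} dN(0,S) = ∑_{j∈s} S_{a, c j} ∫ ∏_{i∈s∖{j}} y_{c i} dN(0,S)`.
[cite: GlimmJaffeQP1987, Thm 6.3.1 (6.3.3) and §8.2 (8.2.1)] -/
theorem integral_eval_mul_prod_multivariateGaussian (hS : S.PosSemidef) (a : ι) {κ : Type*} [DecidableEq κ]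
    (s : Finset κ) (c : κ → ι) :
    ∫ y, y a * ∏ j ∈ s, y (c j) ∂multivariateGaussian 0 S =
      ∑ j ∈ s, S a (c j) * ∫ y, ∏ i ∈ s.erase j, y (c i) ∂multivariateGaussian 0 S := by
  rw [integral_mul_prod_eq_sum (isGaussianProcess_eval_multivariateGaussian 0 S)
    (integral_eval_multivariateGaussian_zero S) a s c]
  exact Finset.sum_congr rfl fun j _ => by rw [integral_eval_mul_eval_multivariateGaussian hS]

/-- the four-point case of `N(0, S)`: `∫ y_{x₀}y_{x₁}y_{x₂}y_{x₃} dN(0,S) = S₀₁S₂₃ + S₀₂S₁₃ + S₀₃S₁₂`. [cite: Janson1997, Thm 1.28 (1.2)] -/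
theorem integral_eval_four_multivariateGaussian (hS : S.PosSemidef) (x : Fin 4 → ι) :
    ∫ y, y (x 0) * y (x 1) * y (x 2) * y (x 3) ∂multivariateGaussian 0 S =
      S (x 0) (x 1) * S (x 2) (x 3) + S (x 0) (x 2) * S (x 1) (x 3) + S (x 0) (x 3) * S (x 1) (x 2) := by
  rw [integral_prod_four (isGaussianProcess_eval_multivariateGaussian 0 S) (integral_eval_multivariateGaussian_zero S) x]
  simp only [integral_eval_mul_eval_multivariateGaussian hS]

end GaussianWick

end Literature.Probability.Distributions
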